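import Summits.MatrixMultiplication.MatrixMultiplication.Theorems.FarEdgeDescentCommutantObstruction
import Summits.MatrixMultiplication.MatrixMultiplication.Theorems.FarEdgeDescentSignTwistCore
import HarnessLib

/-!
# `𝔖^♭ ⋭ 𝔖^♭ᵀ`: the two sign twists are separated by the `y`-pencil commutant

Route `FarEdgeDescent` (cell `decomp-mm`, lens 2 «structural dichotomy (special vs generic)»,
gen 32), Kernel VII concluded; support for the aside `SubLogRate` (stmt-MatrixMultiplication-25371).

The sign star `𝔖^♭` (`(X, (y, y')) ↦ (Xy, X^♭y')`) and its transpose `𝔖^♭ᵀ`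
(`(X, (y, y')) ↦ (Xy, (X^♭)ᵀy')`) have the same quantum functionals
(`FarEdgeDescentTwistQuantumTwin`)
and the same determinant class `det · perm` (`FarEdgeDescentTwistDetClass`), so neither obstruction
of the previous kernels separates them.  What does is the COMMUTANT of the slice pencil in the
`y`-direction (BCS (15.19) in the form `FarEdgeDescentCommutantObstruction`, applied after a cyclic
rotation of the three legs, `algDegeneratesTo_rot`): the pairs
`(β, γ) ∈ End(K^{2×2}) × End(K^{2⊕2})`
with `β · S_y = S_y · γ` for all `y`-slices `S_y` form

* a `2`-dimensional space for `𝔖^♭` (block scalars by the ROW of `X` / of the leaf coordinate: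
  `βr`, `γr`, `hcomm_signStar`), but
* only the scalars for `𝔖^♭ᵀ` (`comm_signTStar`: the transposed reading of the second leaf ties the
  row blocks to the column blocks).

Since the commutant dimension can only grow under degeneration, `𝔖^♭ ⋭ 𝔖^♭ᵀ` over EVERY field
(`signStar_not_algDegeneratesTo_signTStar`; in characteristic `2` this is the coherent star versus
the transposition twist).  With `FarEdgeDescentTwistRigidity` (`⟨2,2,2⟩ ⋭ ᵀ, ♭, ♭ᵀ`),
`FarEdgeDescentSignTwistDet` (`♭, ♭ᵀ ⋭ ⟨2,2,2⟩`), `FarEdgeDescentTwistImage` (`ᵀ ⋭ ⟨2,2,2⟩`) and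
`FarEdgeDescentTwistDetClass` (`ᵀ` versus `♭, ♭ᵀ`) this leaves exactly ONE undecided ordered pair
among the four classes `{⟨2,2,2⟩, ᵀ, ♭, ♭ᵀ}` at `N = 1`: whether `𝔖^♭ᵀ ⊵ 𝔖^♭`.

References: P. Bürgisser, M. Clausen, M. A. Shokrollahi, *Algebraic Complexity Theory* (1997),
(15.19), §20.2 [BurgisserClausenShokrollahi1997]; H. Cohn, C. Umans, SODA 2013, §3 [CohnUmans2013];
M. Bläser, M. Christandl, J. Zuiddam, arXiv:1705.09652, Def. 5 [BlaserChristandlZuiddam2017].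
-/

noncomputable section

open scoped BigOperators Polynomial Matrix

set_option linter.dupNamespace false

namespace Summit.MatrixMultiplication.MatrixMultiplication.Theorems.FarEdgeDescentSignTwistComm

open Literature.Computability.AlgebraicComplexity
open Summit.MatrixMultiplication.MatrixMultiplication.Theorems.FarEdgeDescentCommutantObstruction
open Summit.MatrixMultiplication.MatrixMultiplication.Theorems.FarEdgeDescentSignTwist

universe u

/-! ## Cyclic rotation of the legs -/

section Rot
variable {K : Type u} {ι κ μ ι' κ' μ' : Type*}

/-- **Cyclic rotation of the legs**: `rot s b c a = s a b c` (the old third leg becomes the middle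
one, so that `slice (rot s) c` is the `c`-slice of `s`). [folklore] -/
def rot (s : ι → κ → μ → K) : κ → μ → ι → K := fun b c a => s a b c

/-- Entries of the rotation. [folklore] -/
@[simp] theorem rot_apply (s : ι → κ → μ → K) (b : κ) (c : μ) (a : ι) : rot s b c a = s a b c := rfl

/-- **Approximate restrictions rotate.** [cite: BurgisserClausenShokrollahi1997, (15.19)] -/
theorem isApproxRestriction_rot [Field K] [Fintype ι] [Fintype κ] [Fintype μ] {h : ℕ}
    {s : ι → κ → μ → K}
    {t : ι' → κ' → μ' → K} {A : ι' → ι → K[X]} {B : κ' → κ → K[X]} {C : μ' → μ → K[X]}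
    (hd : IsApproxRestriction h s t A B C) : IsApproxRestriction h (rot s) (rot t) B C A := by
  intro b' c' a' j hj
  have hsum : (∑ b, ∑ c, ∑ a, B b' b * C c' c * A a' a * Polynomial.C (rot s b c a)) =
      ∑ a, ∑ b, ∑ c, A a' a * B b' b * C c' c * Polynomial.C (s a b c) := by
    calc (∑ b, ∑ c, ∑ a, B b' b * C c' c * A a' a * Polynomial.C (rot s b c a))
        = ∑ b, ∑ a, ∑ c, A a' a * B b' b * C c' c * Polynomial.C (s a b c) := by
          refine Finset.sum_congr rfl fun b _ => ?_
          rw [Finset.sum_comm]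
          refine Finset.sum_congr rfl fun a _ => Finset.sum_congr rfl fun c _ => ?_
          rw [rot_apply]; ring
      _ = ∑ a, ∑ b, ∑ c, A a' a * B b' b * C c' c * Polynomial.C (s a b c) := Finset.sum_comm
  rw [hsum]
  exact hd a' b' c' j hj

/-- **Degenerations rotate**: `s ⊵ t → rot s ⊵ rot t`.
[cite: BurgisserClausenShokrollahi1997, (15.19)] -/
theorem algDegeneratesTo_rot [Field K] [Fintype ι] [Fintype κ] [Fintype μ] {s : ι → κ → μ → K}
    {t : ι' → κ' → μ' → K} (h : AlgDegeneratesTo s t) : AlgDegeneratesTo (rot s) (rot t) := by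
  obtain ⟨h, A, B, C, hd⟩ := h
  exact ⟨h, B, C, A, isApproxRestriction_rot hd⟩

end Rot

/-! ## Closed forms and contractions of the sign stars -/

section Closed
variable (K : Type u) [Field K]

/-- `𝔖^♭` on the first leaf. [folklore] -/
theorem signStar_inl_inl (i k : Fin 2) (l l' : Fin 1) (x : (Fin 2 × Fin 2)) :
    signStar K (Sum.inl (i, l)) x (Sum.inl (k, l')) = if x = (i, k) then 1 else 0 := by
  obtain rfl : l = 0 := Subsingleton.elim _ _
  obtain rfl : l' = 0 := Subsingleton.elim _ _
  obtain ⟨x₁, x₂⟩ := x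
  fin_cases i <;> fin_cases k <;> fin_cases x₁ <;> fin_cases x₂ <;> simp [matMulTensor]

/-- `𝔖^♭` on the second leaf. [folklore] -/
theorem signStar_inr_inr (i k : Fin 2) (l l' : Fin 1) (x : (Fin 2 × Fin 2)) :
    signStar K (Sum.inr (i, l)) x (Sum.inr (k, l')) =
      if x = (i, k) then sgnWeight K (i, k) else 0 := by
  obtain rfl : l = 0 := Subsingleton.elim _ _
  obtain rfl : l' = 0 := Subsingleton.elim _ _
  obtain ⟨x₁, x₂⟩ := x
  fin_cases i <;> fin_cases k <;> fin_cases x₁ <;> fin_cases x₂ <;> simp [matMulTensor, sgnWeight]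

/-- `𝔖^♭` vanishes across the leaves. [folklore] -/
theorem signStar_inl_inr (z z' : Fin 2 × Fin 1) (x : Fin 2 × Fin 2) :
    signStar K (Sum.inl z) x (Sum.inr z') = 0 := rfl

/-- `𝔖^♭` vanishes across the leaves. [folklore] -/
theorem signStar_inr_inl (z z' : Fin 2 × Fin 1) (x : Fin 2 × Fin 2) :
    signStar K (Sum.inr z) x (Sum.inl z') = 0 := rfl

/-- `𝔖^♭ᵀ` on the first leaf. [folklore] -/
theorem signTStar_inl_inl (i k : Fin 2) (l l' : Fin 1) (x : (Fin 2 × Fin 2)) :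
    signTStar K (Sum.inl (i, l)) x (Sum.inl (k, l')) = if x = (i, k) then 1 else 0 := by
  obtain rfl : l = 0 := Subsingleton.elim _ _
  obtain rfl : l' = 0 := Subsingleton.elim _ _
  obtain ⟨x₁, x₂⟩ := x
  fin_cases i <;> fin_cases k <;> fin_cases x₁ <;> fin_cases x₂ <;> simp [matMulTensor]

/-- `𝔖^♭ᵀ` on the second leaf (transposed reading). [folklore] -/
theorem signTStar_inr_inr (i k : Fin 2) (l l' : Fin 1) (x : (Fin 2 × Fin 2)) :
    signTStar K (Sum.inr (i, l)) x (Sum.inr (k, l')) =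
      if x = (k, i) then sgnWeight K (k, i) else 0 := by
  obtain rfl : l = 0 := Subsingleton.elim _ _
  obtain rfl : l' = 0 := Subsingleton.elim _ _
  obtain ⟨x₁, x₂⟩ := x
  fin_cases i <;> fin_cases k <;> fin_cases x₁ <;> fin_cases x₂ <;> simp [matMulTensor, sgnWeight]

/-- `𝔖^♭ᵀ` vanishes across the leaves. [folklore] -/
theorem signTStar_inl_inr (z z' : Fin 2 × Fin 1) (x : Fin 2 × Fin 2) :
    signTStar K (Sum.inl z) x (Sum.inr z') = 0 := rfl

/-- `𝔖^♭ᵀ` vanishes across the leaves. [folklore] -/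
theorem signTStar_inr_inl (z z' : Fin 2 × Fin 1) (x : Fin 2 × Fin 2) :
    signTStar K (Sum.inr z) x (Sum.inl z') = 0 := rfl

/-- Right contraction of a `y`-slice of `𝔖^♭ᵀ`, first leaf. [folklore] -/
theorem sumR_signTStar_inl (g : (Fin 2 × Fin 1 ⊕ Fin 2 × Fin 1) → K) (b : Fin 2 × Fin 2) (k : Fin 2)
    (l : Fin 1) :
    ∑ y : ((Fin 2 × Fin 1) ⊕ (Fin 2 × Fin 1)), signTStar K y b (Sum.inl (k, l)) * g y =
      if b.2 = k then g (Sum.inl (b.1, 0)) else 0 := by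
  obtain rfl : l = 0 := Subsingleton.elim _ _
  obtain ⟨b₁, b₂⟩ := b
  fin_cases b₁ <;> fin_cases b₂ <;> fin_cases k <;>
    simp [Fintype.sum_sum_type, Fintype.sum_prod_type, matMulTensor]

/-- Right contraction of a `y`-slice of `𝔖^♭ᵀ`, second leaf. [folklore] -/
theorem sumR_signTStar_inr (g : (Fin 2 × Fin 1 ⊕ Fin 2 × Fin 1) → K) (b : Fin 2 × Fin 2) (k : Fin 2)
    (l : Fin 1) :
    ∑ y : ((Fin 2 × Fin 1) ⊕ (Fin 2 × Fin 1)), signTStar K y b (Sum.inr (k, l)) * g y =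
      if b.1 = k then sgnWeight K b * g (Sum.inr (b.2, 0)) else 0 := by
  obtain rfl : l = 0 := Subsingleton.elim _ _
  obtain ⟨b₁, b₂⟩ := b
  fin_cases b₁ <;> fin_cases b₂ <;> fin_cases k <;>
    simp [Fintype.sum_sum_type, Fintype.sum_prod_type, matMulTensor, sgnWeight]

end Closed

/-! ## The commutant of the `y`-pencil of `𝔖^♭ᵀ` is scalar -/

section CommT
variable (K : Type u) [Field K]

/-- **The `y`-pencil of `𝔖^♭ᵀ` has scalar commutant**: `β S_y = S_y γ` for all `y`-slices forces
`β = p·1`, `γ = p·1`. [cite: BurgisserClausenShokrollahi1997, (15.19)] -/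
theorem comm_signTStar (β' : Matrix (Fin 2 × Fin 2) (Fin 2 × Fin 2) K)
    (γ' : Matrix ((Fin 2 × Fin 1) ⊕ (Fin 2 × Fin 1)) ((Fin 2 × Fin 1) ⊕ (Fin 2 × Fin 1)) K)
    (H : ∀ c, β' * slice (rot (signTStar K)) c = slice (rot (signTStar K)) c * γ') :
    β' = γ' (Sum.inl (0, 0)) (Sum.inl (0, 0)) • (1 : Matrix (Fin 2 × Fin 2) (Fin 2 × Fin 2) K) ∧
      γ' = γ' (Sum.inl (0, 0)) (Sum.inl (0, 0)) •
        (1 : Matrix ((Fin 2 × Fin 1) ⊕ (Fin 2 × Fin 1)) ((Fin 2 × Fin 1) ⊕ (Fin 2 × Fin 1)) K) := by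
  have E : ∀ c b a, ∑ x, β' b x * signTStar K a x c = ∑ y, signTStar K y b c * γ' y a := by
    intro c b a
    have := congr_fun (congr_fun (H c) b) a
    simpa only [Matrix.mul_apply, slice_apply, rot_apply] using this
  -- the four families of scalar equations
  have F1 : ∀ (b : (Fin 2 × Fin 2)) (i k : Fin 2),
      β' b (i, k) = if b.2 = k then γ' (Sum.inl (b.1, 0)) (Sum.inl (i, 0)) else 0 := by
    intro b i k
    have := E (Sum.inl (k, 0)) b (Sum.inl (i, 0))
    simp only [signTStar_inl_inl, mul_ite, mul_one, mul_zero, Finset.sum_ite_eq',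
      Finset.mem_univ, if_true] at this
    rwa [sumR_signTStar_inl] at this
  have F2 : ∀ (b : (Fin 2 × Fin 2)) (i k : Fin 2),
      (if b.2 = k then γ' (Sum.inl (b.1, 0)) (Sum.inr (i, 0)) else 0) = 0 := by
    intro b i k
    have := E (Sum.inl (k, 0)) b (Sum.inr (i, 0))
    simp only [signTStar_inr_inl, mul_zero, Finset.sum_const_zero] at this
    rw [sumR_signTStar_inl] at this
    exact this.symm
  have F3 : ∀ (b : (Fin 2 × Fin 2)) (i k : Fin 2),
      (if b.1 = k then sgnWeight K b * γ' (Sum.inr (b.2, 0)) (Sum.inl (i, 0)) else 0) = 0 := by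
    intro b i k
    have := E (Sum.inr (k, 0)) b (Sum.inl (i, 0))
    simp only [signTStar_inl_inr, mul_zero, Finset.sum_const_zero] at this
    rw [sumR_signTStar_inr] at this
    exact this.symm
  have F4 : ∀ (b : (Fin 2 × Fin 2)) (i k : Fin 2),
      β' b (k, i) * sgnWeight K (k, i) =
        if b.1 = k then sgnWeight K b * γ' (Sum.inr (b.2, 0)) (Sum.inr (i, 0)) else 0 := by
    intro b i k
    have := E (Sum.inr (k, 0)) b (Sum.inr (i, 0))
    simp only [signTStar_inr_inr, mul_ite, mul_zero, Finset.sum_ite_eq', Finset.mem_univ,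
      if_true] at this
    rwa [sumR_signTStar_inr] at this
  set p : K := γ' (Sum.inl (0, 0)) (Sum.inl (0, 0)) with hp
  -- the entries of γ'
  have gLR : ∀ j i : Fin 2, γ' (Sum.inl (j, 0)) (Sum.inr (i, 0)) = 0 := fun j i => by
    simpa using F2 (j, 0) i 0
  have gRL : ∀ j i : Fin 2, γ' (Sum.inr (j, 0)) (Sum.inl (i, 0)) = 0 := fun j i => by
    simpa [sgnWeight] using F3 (0, j) i 0
  have gRRd : ∀ i : Fin 2, γ' (Sum.inr (i, 0)) (Sum.inr (i, 0)) = p := fun i => by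
    have h1 := F1 (0, i) 0 i
    simp at h1
    have h4 := F4 (0, i) i 0
    simp [sgnWeight] at h4
    rw [← h4, h1]
  have gRRo : ∀ j i : Fin 2, j ≠ i → γ' (Sum.inr (j, 0)) (Sum.inr (i, 0)) = 0 := fun j i hji => by
    have h1 := F1 (0, j) 0 i
    simp [hji] at h1
    have h4 := F4 (0, j) i 0
    simp [sgnWeight] at h4
    rw [← h4, h1]
  have gLLd : ∀ j : Fin 2, γ' (Sum.inl (j, 0)) (Sum.inl (j, 0)) = p := fun j => by
    have h1 := F1 (j, 1) j 1
    simp at h1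
    have h4 := F4 (j, 1) 1 j
    simp [sgnWeight] at h4
    rw [← h1, h4, gRRd]
  have gLLo : ∀ j i : Fin 2, j ≠ i → γ' (Sum.inl (j, 0)) (Sum.inl (i, 0)) = 0 := fun j i hji => by
    have h1 := F1 (j, 1) i 1
    simp at h1
    have h4 := F4 (j, 1) 1 i
    simp [sgnWeight, hji] at h4
    rw [← h1, h4]
  have hγ : γ' =
      p • (1 : Matrix (Fin 2 × Fin 1 ⊕ Fin 2 × Fin 1) (Fin 2 × Fin 1 ⊕ Fin 2 × Fin 1) K) := by
    ext y a
    rcases y with ⟨j, l⟩ | ⟨j, l⟩ <;> rcases a with ⟨i, l'⟩ | ⟨i, l'⟩ <;>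
    · obtain rfl : l = 0 := Subsingleton.elim _ _
      obtain rfl : l' = 0 := Subsingleton.elim _ _
      by_cases hji : j = i
      · subst hji
        simp [gLLd, gRRd, gLR, gRL]
      · simp [hji, gLLo, gRRo, gLR, gRL]
  refine ⟨?_, hγ⟩
  ext b x
  obtain ⟨i, k⟩ := x
  obtain ⟨j, k'⟩ := b
  rw [F1, hγ]
  by_cases hji : j = i <;> by_cases hk : k' = k <;> simp [hji, hk]

end CommT

/-! ## Two independent intertwiners of the `y`-pencil of `𝔖^♭` -/

section CommS
variable (K : Type u) [Field K]

/-- The row of a leaf index. [folklore] -/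
def row : (Fin 2 × Fin 1) ⊕ (Fin 2 × Fin 1) → Fin 2 := Sum.elim (fun z => z.1) (fun z => z.1)

/-- Projection of `K^{2×2}` onto the positions of row `r`. [folklore] -/
def βr (r : Fin 2) : Matrix (Fin 2 × Fin 2) (Fin 2 × Fin 2) K :=
  Matrix.diagonal fun b => if b.1 = r then 1 else 0

/-- Projection of `K^{2⊕2}` onto the leaf coordinates of row `r`. [folklore] -/
def γr (r : Fin 2) :
    Matrix (Fin 2 × Fin 1 ⊕ Fin 2 × Fin 1) (Fin 2 × Fin 1 ⊕ Fin 2 × Fin 1) K :=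
  Matrix.diagonal fun a => if row a = r then 1 else 0

/-- `𝔖^♭(a, x, c)` vanishes unless `row a = x.1`. [folklore] -/
theorem signStar_eq_zero_of_row_ne (a : ((Fin 2 × Fin 1) ⊕ (Fin 2 × Fin 1))) (x : Fin 2 × Fin 2)
    (c : ((Fin 2 × Fin 1) ⊕ (Fin 2 × Fin 1))) (h : row a ≠ x.1) :
    signStar K a x c = 0 := by
  rcases a with ⟨i, l⟩ | ⟨i, l⟩ <;> rcases c with ⟨k, l'⟩ | ⟨k, l'⟩
  · rw [signStar_inl_inl, if_neg]; rintro rfl; exact h rfl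
  · rfl
  · rfl
  · rw [signStar_inr_inr, if_neg]; rintro rfl; exact h rfl

/-- **`(βr r, γr r)` intertwines the `y`-pencil of `𝔖^♭`.** [folklore] -/
theorem hcomm_signStar (r : Fin 2) (c : ((Fin 2 × Fin 1) ⊕ (Fin 2 × Fin 1))) :
    βr K r * slice (rot (signStar K)) c = slice (rot (signStar K)) c * γr K r := by
  ext b a
  rw [βr, γr, Matrix.diagonal_mul, Matrix.mul_diagonal, slice_apply, rot_apply]
  by_cases h : row a = b.1
  · rw [h, mul_comm]
  · rw [signStar_eq_zero_of_row_ne K a b c h, mul_zero, zero_mul]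

/-- The two projections `βr 0, βr 1` are linearly independent. [folklore] -/
theorem βr_linearIndependent : LinearIndependent K (βr K) := by
  refine Fintype.linearIndependent_iff.mpr fun g hg r => ?_
  fin_cases r
  · simpa [βr, Finset.sum_apply, Fin.sum_univ_two, Matrix.diagonal_apply_eq] using
      congr_fun (congr_fun hg (0, 0)) (0, 0)
  · simpa [βr, Finset.sum_apply, Fin.sum_univ_two, Matrix.diagonal_apply_eq] using
      congr_fun (congr_fun hg (1, 0)) (1, 0)

end CommS

/-! ## The theorem -/

section Main
variable (K : Type u) [Field K]

/-- **`𝔖^♭ ⋭ 𝔖^♭ᵀ` over every field** (single copy): the `y`-pencil commutant of `𝔖^♭` contains two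
independent pairs, that of `𝔖^♭ᵀ` only the scalars, and the commutant can only grow under
degeneration (BCS (15.19)). [cite: BurgisserClausenShokrollahi1997, (15.19), sec. 20.2] -/
theorem signStar_not_algDegeneratesTo_signTStar :
    ¬ AlgDegeneratesTo (signStar K) (signTStar K) := by
  intro h
  set x : Matrix (Fin 2 × Fin 2) (Fin 2 × Fin 2) K ×
      Matrix (Fin 2 × Fin 1 ⊕ Fin 2 × Fin 1) (Fin 2 × Fin 1 ⊕ Fin 2 × Fin 1) K := (1, 1) with hx
  refine not_algDegeneratesTo_of_commutant (R₀ := Fin 2) (rot (signStar K)) (rot (signTStar K))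
    (βr K) (γr K) (hcomm_signStar K) (βr_linearIndependent K) (K ∙ x) ?_ ?_ (algDegeneratesTo_rot h)
  · intro β' γ' H
    obtain ⟨hb, hg⟩ := comm_signTStar K β' γ' H
    rw [Submodule.mem_span_singleton]
    exact ⟨γ' (Sum.inl (0, 0)) (Sum.inl (0, 0)), by rw [hx, Prod.smul_mk, ← hb, ← hg]⟩
  · calc Module.finrank K (K ∙ x) ≤ 1 := (finrank_span_le_card ({x} : Set _)).trans (by simp)
      _ < Fintype.card (Fin 2) := by simp

end Main

end Summit.MatrixMultiplication.MatrixMultiplication.Theorems.FarEdgeDescentSignTwistComm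

end
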